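import Literature.AlgebraicGeometry.Modules.PullbackStalk
import Literature.AlgebraicGeometry.Modules.TensorStalkPresheaf
import Literature.AlgebraicGeometry.Modules.SectionsExact
import Literature.AlgebraicGeometry.Morphisms.DevissageClass
import HarnessLib

/-!
# Stalks of `𝒪_X`-modules: exactness on short exact sequences, and finiteness for coherent modules

Layer `Literature/AlgebraicGeometry/Modules` (0 definitions, 0 named facts, no instances, no notation). Two standard
facts about the stalk functor `M ↦ M_x` of `Modules/SkyscraperModule.stalkFunctor` (Görtz–Wedhorn I (7.8.6), Hartshorne
II §1 and Prop. 5.4):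

* §1 **a short exact sequence `0 → M′ → M → M″ → 0` of `𝒪_X`-modules has short exact stalk sequences**
  `0 → M′_x → M_x → M″_x → 0` (Hartshorne II Ex. 1.2 / Prop. 1.1: exactness of sheaves is stalkwise): injectivity is
  the tree's `Modules/PullbackStalk.stalkFunctor_map_injective_of_mono`; surjectivity from the local liftability of
  sections through an epimorphism (`Motives/ChernClassesProofs.Scheme.Modules.exists_app_eq_of_epi`); exactness in the
  middle from the left exactness of sections (`Modules/SectionsExact.sections_exact_of_shortExact`) and Mathlib's
  `TopCat.Presheaf.germ_eq` — `stalkFunctor_map_surjective_of_epi`, `exact_stalkFunctor_map_of_shortExact`,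
  `shortExact_map_stalkFunctor`;
* §2 **the stalk of a coherent module is a finitely generated `𝒪_{X,x}`-module** (`moduleFinite_stalk_of_coh`;
  Hartshorne II Prop. 5.4 / GW I Prop. 7.29: on an affine open `V ∋ x`, `M_x` is generated by the germs of the finitely
  many generators of `Γ(V, M)`, every germ being a germ over a basic open `D(r) ∋ x`, where sections are fractions
  `m ∕ rⁿ` by the affine-localizing property `Modules/AffineLocalizing.IsAffineLocalizing.numerator` and `germ r` is a
  unit).

## References

* R. Hartshorne, *Algebraic Geometry*, GTM 52 (1977), II Prop. 1.1 and Ex. 1.2 (p. 63–66), II Prop. 5.4 (p. 113). [Hartshorne1977]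
* U. Görtz, T. Wedhorn, *Algebraic Geometry I*, 2nd ed. (2020), (7.8.6), Prop. 7.29. [GortzWedhorn2020]
-/

noncomputable section

-- `TopCat.Presheaf`/`Scheme.Modules` are not reducible (as in Mathlib's `AlgebraicGeometry/Modules`).
set_option backward.isDefEq.respectTransparency false

universe u

open CategoryTheory CategoryTheory.Limits AlgebraicGeometry TopologicalSpace Opposite

namespace Literature.AlgebraicGeometry.Modules

open Literature.AlgebraicGeometry.Morphisms Literature.AlgebraicGeometry.Motives

variable {X : Scheme.{u}} (x : X)

/-! ## §1 Stalks of a short exact sequence -/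

/-- The stalk functor sends the zero morphism to zero. [cite: GortzWedhorn2020, (7.8.6)] -/
theorem stalkFunctor_map_zero (M N : X.Modules) : (stalkFunctor x).map (0 : M ⟶ N) = 0 := by
  ext v
  obtain ⟨U, hxU, m, rfl⟩ := exists_stalkGerm_eq x M v
  rw [stalkFunctor_map_germ]
  have h0 : (0 : M ⟶ N).app U m = 0 := by simp [Scheme.Modules.Hom.zero_app]
  rw [h0, stalkGerm_zero]
  simp

/-- The stalk functor preserves zero morphisms (a theorem; bind with `haveI`). [cite: GortzWedhorn2020, (7.8.6)] -/
theorem preservesZeroMorphisms_stalkFunctor : (stalkFunctor (X := X) x).PreservesZeroMorphisms :=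
  ⟨fun M N => stalkFunctor_map_zero x M N⟩

/-- **The stalk map of an epimorphism of `𝒪_X`-modules is surjective**: a germ of a section `t` of `N` lifts because
`t` lifts through `φ` on some neighbourhood of `x`. [cite: Hartshorne1977, II Prop. 1.1 (p. 63)] -/
theorem stalkFunctor_map_surjective_of_epi {M N : X.Modules} (φ : M ⟶ N) [Epi φ] :
    Function.Surjective ((stalkFunctor x).map φ) := by
  intro v
  obtain ⟨U, hxU, t, rfl⟩ := exists_stalkGerm_eq x N v
  obtain ⟨V, hVU, hxV, s, hs⟩ := Scheme.Modules.exists_app_eq_of_epi φ U t x hxU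
  refine ⟨stalkGerm x M V hxV s, ?_⟩
  rw [stalkFunctor_map_germ, hs]
  exact TopCat.Presheaf.germ_res_apply N.presheaf (homOfLE hVU) x hxV t

/-- **Exactness of stalks in the middle**: for a short exact sequence `0 → M′ → M → M″ → 0`, a germ of `M` killed by
`g_x` is in the image of `f_x` (the section `g s` has zero germ, so vanishes on a neighbourhood, where `s` comes from
`M′` by the left exactness of sections). [cite: Hartshorne1977, II Ex. 1.2 (c) (p. 66)] -/
theorem exact_stalkFunctor_map_of_shortExact {S : ShortComplex X.Modules} (hS : S.ShortExact)
    (v : (stalkFunctor x).obj S.X₂) (hv : (stalkFunctor x).map S.g v = 0) :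
    ∃ w : (stalkFunctor x).obj S.X₁, (stalkFunctor x).map S.f w = v := by
  obtain ⟨U, hxU, s, rfl⟩ := exists_stalkGerm_eq x S.X₂ v
  rw [stalkFunctor_map_germ] at hv
  -- `g s` has zero germ at `x`, hence vanishes on some `V ∋ x`
  have h0 : S.X₃.presheaf.germ U x hxU (S.g.app U s) = S.X₃.presheaf.germ U x hxU 0 := by
    rw [map_zero]; exact hv
  obtain ⟨V, hxV, iU, iV, hres⟩ := TopCat.Presheaf.germ_eq S.X₃.presheaf x hxU hxU _ _ h0
  rw [map_zero] at hres
  have hgs : S.g.app V (S.X₂.presheaf.map iU.op s) = 0 := by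
    rw [Scheme.Modules.Hom.app_map_apply, hres]
  obtain ⟨s', hs'⟩ := (sections_exact_of_shortExact hS V).2 _ hgs
  refine ⟨stalkGerm x S.X₁ V hxV s', ?_⟩
  rw [stalkFunctor_map_germ, hs']
  exact TopCat.Presheaf.germ_res_apply S.X₂.presheaf iU x hxV s

/-- **Stalks of a short exact sequence of `𝒪_X`-modules are short exact** (`0 → M′_x → M_x → M″_x → 0` in
`𝒪_{X,x}`-modules). [cite: Hartshorne1977, II Ex. 1.2 (c) (p. 66)] [cite: GortzWedhorn2020, (7.8.6)] -/
theorem shortExact_map_stalkFunctor {S : ShortComplex X.Modules} (hS : S.ShortExact) :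
    haveI := preservesZeroMorphisms_stalkFunctor (X := X) x
    (S.map (stalkFunctor x)).ShortExact := by
  haveI := preservesZeroMorphisms_stalkFunctor (X := X) x
  haveI := hS.mono_f
  haveI := hS.epi_g
  refine ShortComplex.ShortExact.mk' ?_ ?_ ?_
  · exact (ShortComplex.moduleCat_exact_iff _).mpr fun v hv => exact_stalkFunctor_map_of_shortExact x hS v hv
  · exact (ModuleCat.mono_iff_injective _).mpr (stalkFunctor_map_injective_of_mono S.f x)
  · exact (ModuleCat.epi_iff_surjective _).mpr (stalkFunctor_map_surjective_of_epi x S.g)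

/-! ## §2 The stalk of a coherent module is finitely generated -/

/-- Germs are compatible with the module structures: `germ (a • m) = germ a • germ m` for a section `a` of `𝒪_X`
and a section `m` of `M` over the same open (the tree's `germ_smul`, restated for `stalkGerm`). [cite: GortzWedhorn2020, (7.8.6) with (7.4.7)] -/
theorem stalkGerm_smul (M : X.Modules) (U : X.Opens) (hx : x ∈ U) (a : Γ(X, U)) (m : Γ(M, U)) :
    stalkGerm x M U hx (a • m) = X.presheaf.germ U x hx a • stalkGerm x M U hx m :=
  germ_smul x M U hx a m

/-- On an affine open `V ∋ x`, **every element of `M_x` is `u⁻ⁿ • germ m` for a section `m ∈ Γ(V, M)`** and a unit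
`u = germ r` (`M` affine-localizing): a germ over `W` is a germ over a basic open `D(r) ⊆ W ∩ V`, and sections over
`D(r)` are fractions `m ∕ rⁿ`. Stated as membership in the `𝒪_{X,x}`-span of the germs of `Γ(V, M)`.
[cite: Hartshorne1977, II Prop. 5.4 (p. 113) with Lemma 5.3] -/
theorem mem_span_stalkGerm_of_isAffineLocalizing {M : X.Modules} (hM : IsAffineLocalizing M) {V : X.Opens}
    (hV : IsAffineOpen V) (hxV : x ∈ V) (v : (stalkFunctor x).obj M) :
    v ∈ Submodule.span (X.presheaf.stalk x) (Set.range fun m : Γ(M, V) => stalkGerm x M V hxV m) := by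
  obtain ⟨W, hxW, s, rfl⟩ := exists_stalkGerm_eq x M v
  -- a basic open `D(r) ⊆ W ⊓ V` around `x`
  have hxWV : x ∈ W ⊓ V := Opens.mem_inf.mpr ⟨hxW, hxV⟩
  obtain ⟨r, hrW, hxr⟩ := hV.exists_basicOpen_le ⟨x, hxWV⟩ hxV
  have hrW' : X.basicOpen r ≤ W := hrW.trans inf_le_left
  have hrV : X.basicOpen r ≤ V := X.basicOpen_le r
  -- numerator: `m|_{D(r)} = r|ⁿ • s|_{D(r)}`
  obtain ⟨n, m, hm⟩ := hM.numerator hV r rfl (M.presheaf.map (homOfLE hrW').op s)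
  -- `germ r` is a unit at `x ∈ D(r)`
  have hunit : IsUnit (X.presheaf.germ V x hxV r) := (X.mem_basicOpen r x hxV).mp hxr
  obtain ⟨u, hu⟩ := hunit
  -- rewrite the germ of `s` as `u⁻ⁿ • germ m`
  have hgerm : stalkGerm x M W hxW s =
      ((u⁻¹ ^ n : (X.presheaf.stalk x)ˣ) : X.presheaf.stalk x) • stalkGerm x M V hxV m := by
    have h₁ : stalkGerm x M (X.basicOpen r) hxr (M.presheaf.map (homOfLE hrW').op s) = stalkGerm x M W hxW s :=
      TopCat.Presheaf.germ_res_apply M.presheaf (homOfLE hrW') x hxr s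
    have h₂ : stalkGerm x M (X.basicOpen r) hxr (M.presheaf.map (homOfLE hrV).op m) = stalkGerm x M V hxV m :=
      TopCat.Presheaf.germ_res_apply M.presheaf (homOfLE hrV) x hxr m
    have h₃ := congrArg (stalkGerm x M (X.basicOpen r) hxr) hm
    rw [stalkGerm_smul, map_pow, TopCat.Presheaf.germ_res_apply X.presheaf (homOfLE hrV) x hxr r, ← hu, h₁] at h₃
    -- `h₃ : germ_{D(r)} (m|) = u ^ n • germ_W s`
    change stalkGerm x M (X.basicOpen r) hxr (M.presheaf.map (homOfLE hrV).op m) = _ at h₃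
    rw [h₂] at h₃
    rw [h₃, ← Units.val_pow_eq_pow_val, smul_smul, ← Units.val_mul, inv_pow, inv_mul_cancel, Units.val_one, one_smul]
  rw [hgerm]
  exact Submodule.smul_mem _ _ (Submodule.subset_span ⟨m, rfl⟩)

/-- **The stalk `M_x` of a coherent `𝒪_X`-module is a finitely generated `𝒪_{X,x}`-module**: on an affine open
`V ∋ x` it is generated by the germs of finitely many generators of the `Γ(V, 𝒪_X)`-module `Γ(V, M)`.
[cite: Hartshorne1977, II Prop. 5.4 (p. 113)] [cite: GortzWedhorn2020, Prop. 7.29] -/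
theorem moduleFinite_stalk_of_coh {M : X.Modules} (hM : Coh M) :
    Module.Finite (X.presheaf.stalk x) ((stalkFunctor x).obj M) := by
  classical
  obtain ⟨V, hV, hxV, -⟩ := exists_isAffineOpen_mem_and_subset (X := X) (x := x) (U := ⊤) trivial
  haveI : Module.Finite Γ(X, V) Γ(M, V) := hM.ft hV
  obtain ⟨T, hT⟩ := Module.Finite.fg_top (R := Γ(X, V)) (M := Γ(M, V))
  refine ⟨⟨T.image fun m => stalkGerm x M V hxV m, ?_⟩⟩
  rw [Finset.coe_image, eq_top_iff]
  intro v _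
  -- every germ of a section over `V` lies in the span of the germs of the generators
  have hgen : ∀ m : Γ(M, V), stalkGerm x M V hxV m ∈
      Submodule.span (X.presheaf.stalk x) ((fun m => stalkGerm x M V hxV m) '' (T : Set Γ(M, V))) := by
    intro m
    have hm : m ∈ Submodule.span Γ(X, V) (T : Set Γ(M, V)) := by rw [hT]; trivial
    induction hm using Submodule.span_induction with
    | mem m hm => exact Submodule.subset_span ⟨m, hm, rfl⟩
    | zero => rw [stalkGerm_zero]; exact Submodule.zero_mem _
    | add m m' _ _ hm hm' => rw [stalkGerm_add]; exact Submodule.add_mem _ hm hm'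
    | smul a m _ hm => rw [stalkGerm_smul]; exact Submodule.smul_mem _ _ hm
  -- and every element of `M_x` lies in the span of the germs of sections over `V`
  have hv := mem_span_stalkGerm_of_isAffineLocalizing x hM.loc hV hxV v
  refine Submodule.span_le.mpr ?_ hv
  rintro _ ⟨m, rfl⟩
  exact hgen m

end Literature.AlgebraicGeometry.Modules

end
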